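import Summits.BirchSwinnertonDyer.BirchSwinnertonDyer.Theorems.ManinLocalTwoThreeStevensCurveRatPresentation
import Summits.BirchSwinnertonDyer.BirchSwinnertonDyer.Theorems.ManinLocalTwoThreeStevensCurveDatum
import Summits.BirchSwinnertonDyer.BirchSwinnertonDyer.Theorems.ManinLocalTwoThreeNaturalTes75OfOptimalTwin
import HarnessLib

/-!
# The Stevens datum `(ℂ/Λ₁(f), c = 1)` comes with a RATIONAL `Γ₁(N)`-presentation of `x∘φ₁`
(route `ManinLocalTwoThree`, crux C2 stmt-BirchSwinnertonDyer-22967; cell bsd-f2-manin, prover p3 gen 21; step (0) of the T-es-75 discharge road)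

By p2 gen 23's bridge `NaturalTes75.naturalTes75_of_Tes75_of_optimalTwin` and `StevensCurve.cesWeak`, Stevens 1982 Thm 1.3.1 (b) for ALL `X₁(N)`-data (T-es-75,
even T-es-75♮) follows from the statement for ONE optimal datum per newform.  The canonical choice is the STEVENS DATUM of `…StevensCurveDatum`: the short
model `E₁` of `ℂ/Λ₁(f)` with its optimal `X₁(N)`-datum `D₁`, `D₁.c = 1`, `Λ(D₁.L) = Λ₁(f)`; there `φ₁(τ) = u_{E₁}(ℰ_f τ)` has
`x∘φ₁ = ℘_{Λ₁}(ℰ_f) − b₂(E₁)/12`, `y∘φ₁ = (℘′_{Λ₁}(ℰ_f) − a₁x − a₃)/2`.  This file records, fact-free: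

* `exists_rat_gamma1_presentation_of_gamma1Datum_one` — for ANY `X₁(N)`-datum `D` with `D.c = 1` (so `Λ₁(f) ⊆ Λ(D.L)`): a RATIONAL
  `Γ₁(N)`-presentation of `℘_{Λ(D.L)}(ℰ_f)` (via p2's `exists_modularParametrizationData_of_gamma1` and `exists_rat_gamma1_presentation`);
* `exists_stevensDatum_rat_presentation` — **for every elliptic `W₀` with a lattice-optimal `X₀(N)`-datum `D₀`: the Stevens datum `(W₁, D₁)` (same newform,
  `c = 1`, optimal, `W₁ ∼ W₀`) TOGETHER WITH `k ≥ 1`, `F₁, G₁ ∈ S_k(Γ₁(N))` with rational Fourier coefficients, `G₁ ≠ 0`,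
  `℘_{Λ(D₁.L)}(ℰ_f)·G₁ = F₁` off the poles** — the input the σ-equivariance step (LEAD p1, translates) and the cusp-value step (p2, leading coefficients)
  consume.

HONEST FRAMING: bookkeeping over the Stevens-curve theorem; no named fact; T-es-75, C2/C3, Manin's conjecture and BSD are NOT proved here.
[cite: Stevens1982, §1.3 Thm. 1.3.1 (b)] [cite: Stevens1989, §2] [cite: ShimuraIATAF1971, Thm. 3.52]
-/

set_option autoImplicit false
-- lint-debt: the directory name repeats the summit name (sibling precedent `ManinLocalTwoThreeStevensCurveRatPresentation.lean`)
set_option linter.dupNamespace false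

noncomputable section

open scoped MatrixGroups PeriodPair ModularForm UpperHalfPlane
open UpperHalfPlane hiding I
open CongruenceSubgroup
open Literature.NumberTheory.EllipticCurves Literature.NumberTheory.EllipticCurves.ModularForms

namespace Summit.BirchSwinnertonDyer.BirchSwinnertonDyer.Theorems.ManinLocalTwoThree.StevensCurve

variable {N : ℕ} [NeZero N]

/-- **A rational `Γ₁(N)`-presentation of `℘_{Λ_W}(ℰ_f)` for every `X₁(N)`-datum of Manin constant `1`** (`1·Λ₁(f) ⊆ Λ_W` is the datum's own
clause; the `X₀(N)`-datum of `W` with the same lattice is p2's `NaturalTes75.exists_modularParametrizationData_of_gamma1`). [cite: Stevens1989, §2]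
[cite: ShimuraIATAF1971, Thm. 3.52] -/
theorem exists_rat_gamma1_presentation_of_gamma1Datum_one {W : WeierstrassCurve ℚ} [W.IsElliptic] (D : Gamma1ParametrizationData W N)
    (hc : D.c = 1) :
    ∃ (k : ℤ) (F G : CuspForm (Gamma1 N) k), 1 ≤ k ∧ G ≠ 0 ∧
      (∀ τ : ℍ, eichlerIntegral D.f τ ∉ D.L.lattice → ℘[D.L] (eichlerIntegral D.f τ) * G τ = F τ) ∧
      (∀ n, ∃ q : ℚ, (q : ℂ) = cuspCoeff F n) ∧ (∀ n, ∃ q : ℚ, (q : ℂ) = cuspCoeff G n) := by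
  obtain ⟨D₀, hf, hL, -⟩ := NaturalTes75.exists_modularParametrizationData_of_gamma1 D
  have hSI : ∀ z ∈ periodLatticeGamma1 D₀.f, z ∈ D₀.L.lattice := fun z hz ↦ by
    rw [hL]
    have h := D.smul_periodLatticeGamma1_le z (by rwa [hf] at hz)
    rwa [hc, Int.cast_one, one_mul] at h
  obtain ⟨k, F, G, hk, hG, hFG, hFr, hGr⟩ := exists_rat_gamma1_presentation D₀ hSI
  refine ⟨k, F, G, hk, hG, fun τ hτ ↦ ?_, hFr, hGr⟩
  rw [← hf, ← hL]
  exact hFG τ (by rwa [hL, hf])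

/-- **The Stevens datum with its rational `Γ₁(N)`-presentation.**  For every elliptic `W₀/ℚ` with a lattice-optimal `X₀(N)`-datum `D₀` there are: an
elliptic `W₁/ℚ`, `ℚ`-isogenous to `W₀`, an OPTIMAL `X₁(N)`-datum `D₁` of `W₁` with `D₁.f = D₀.f`, `D₁.c = 1`, `Λ(D₁.L) = Λ₁(f)`, and `k ≥ 1`,
`F₁, G₁ ∈ S_k(Γ₁(N))` with RATIONAL Fourier coefficients, `G₁ ≠ 0`, presenting `℘_{Λ(D₁.L)}(ℰ_f)` (`= x∘φ_{D₁} + b₂(W₁)/12`) off the poles.  Fact-free.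
[cite: Stevens1989, §2] [cite: ShimuraIATAF1971, Thm. 3.52 and Thm. 7.14] -/
theorem exists_stevensDatum_rat_presentation {W₀ : WeierstrassCurve ℚ} [W₀.IsElliptic] (D₀ : ModularParametrizationData W₀ N)
    (hopt : ∀ z ∈ D₀.L.lattice, ∃ w ∈ periodLattice D₀.f, z = D₀.c * w) :
    ∃ (W₁ : WeierstrassCurve ℚ) (_ : W₁.IsElliptic) (D₁ : Gamma1ParametrizationData W₁ N),
      D₁.f = D₀.f ∧ D₁.c = 1 ∧ D₁.IsOptimal ∧ (∀ x, x ∈ D₁.L.lattice ↔ x ∈ periodLatticeGamma1 D₀.f) ∧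
      WeierstrassCurve.IsIsogenous W₁ W₀ ∧
      ∃ (k : ℤ) (F G : CuspForm (Gamma1 N) k), 1 ≤ k ∧ G ≠ 0 ∧
        (∀ τ : ℍ, eichlerIntegral D₀.f τ ∉ D₁.L.lattice → ℘[D₁.L] (eichlerIntegral D₀.f τ) * G τ = F τ) ∧
        (∀ n, ∃ q : ℚ, (q : ℂ) = cuspCoeff F n) ∧ (∀ n, ∃ q : ℚ, (q : ℂ) = cuspCoeff G n) := by
  obtain ⟨W₁, hW₁, D₁, hf, hc, hD₁, hL, hiso⟩ := exists_optimal_gamma1ParametrizationData_one D₀ hopt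
  haveI := hW₁
  obtain ⟨k, F, G, hk, hG, hFG, hFr, hGr⟩ := exists_rat_gamma1_presentation_of_gamma1Datum_one D₁ hc
  refine ⟨W₁, hW₁, D₁, hf, hc, hD₁, hL, hiso, k, F, G, hk, hG, fun τ hτ ↦ ?_, hFr, hGr⟩
  rw [← hf]
  exact hFG τ (by rwa [hf])

end Summit.BirchSwinnertonDyer.BirchSwinnertonDyer.Theorems.ManinLocalTwoThree.StevensCurve

end
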